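import Literature.Analysis.SpecialFunctions.ThetaRiemannSum
import Mathlib.Analysis.SpecialFunctions.Pow.Real
import Mathlib.Analysis.SpecificLimits.Normed
import Mathlib.Analysis.PSeries
import HarnessLib

/-!
# Toolkit for Lemma 5.2 of Ajanki–Huveneers 2011: products of multipliers, lattice sums, tails

Second support file of the provefact unit for `AjankiHuveneers2011_approxKernels` (Lemma 5.2,
eqs. (5.9)–(5.10) of O. Ajanki, F. Huveneers, CMP **301** (2011) 841–883, arXiv:1003.1076,
vendored in `DisorderedHarmonicChainPotential.lean`). Appendix 7.3 of the paper bounds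
`Λ_n(ξ) = ∏_{j=1}^n λ_j(ξw)` and its first two `ξ`-derivatives ((7.x) "`∂_ξΛ_n = w∑_j ∂_zλ_j ∏_{k≠j}
λ_k`", "`∂²_ξΛ_n = w²∑_j (∂²_zλ_j ∏ λ_k + ∂_zλ_j ∑_{k≠j} ∂_zλ_k ∏ λ_l)`") and then sums the
resulting Gaussian / power-law majorants over `ξ ∈ ℤ` ("`I₁ ≲ ∫₀^∞ yˡ e^{-Cny²} dy ≲ n^{-(l+1)/2}`",
"`I₂ ≤ … ≲ e^{-C(ε')n}`"). We use DIFFERENCES in `ξ ∈ ℤ` instead of derivatives; this file provides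
the generic, chain-independent pieces, all PROVED:

* `seqProd_bounds`: for `P_n(η) = ∏_{j<n} f_j(η)` with `|f_j| ≤ r_j` on `{ξ, ξ+1, ξ+2}`,
  `|Δf_j| ≤ d₁`, `|Δ²f_j| ≤ d₂`: `|P_n| ≤ R`, `|ΔP_n| ≤ d₁RS`, `|Δ²P_n| ≤ R(d₂S + d₁²S²)` with
  `R = ∏ r_j`, `S = ∑ r_j⁻¹` (discrete Leibniz + induction) — the difference form of (7.x);
* `norm_diff_mul_le`, `norm_second_diff_mul_le`, `norm_diff_mul_id_le`,
  `norm_second_diff_mul_sq_le`: Leibniz bounds for `Δ(PV)`, `Δ²(PV)`, `Δ(ξa)`, `Δ²(ξ²a)`;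
* `tsum_abs_pow_mul_gauss_le`: `∑_{ξ∈ℤ} |ξ|ˡ e^{-cξ²} ≤ K_l/(√c)^{l+1}` for `0 < c ≤ 1`, uniformly
  as `c → 0` (Poisson summation via `Literature.Analysis.SpecialFunctions.gaussLatticeSum_poisson`
  and `yˡ/l! ≤ eʸ`) — the lattice version of `I₁`;
* `tsum_tailWeight_le`: `∑_{|ξ|>N} |ξ|^{-(q+2)} ≤ 2/N^{q+1}` (telescoping `1/k² ≤ 1/(k-1) - 1/k`) —
  the lattice version of `I₂`; `exists_bound_pow_mul_pow`: `Aᵍgᵖ` is bounded for `0 ≤ A < 1`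
  (how `(1 - ε₁)^{n/2}` beats the polynomial losses).

Everything here is [folklore]; nothing is specific to the harmonic chain and nothing is a named fact.
-/

noncomputable section

open Real Filter Finset
open scoped Topology BigOperators

namespace Literature.Barriers.AtomisticToContinuum.HeatConduction

/-! ### Products of many factors: values, first and second differences -/

section ProductDifferences

variable {f : ℕ → ℤ → ℂ} {r : ℕ → ℝ} {d₁ d₂ : ℝ} {ξ : ℤ}

/-- The product `P_n(η) = ∏_{j<n} f_j(η)` of the first `n` factors. [folklore] -/
def seqProd (f : ℕ → ℤ → ℂ) (n : ℕ) (η : ℤ) : ℂ := ∏ j ∈ Finset.range n, f j η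

/-- `P_0 = 1`. [folklore] -/
theorem seqProd_zero (f : ℕ → ℤ → ℂ) (η : ℤ) : seqProd f 0 η = 1 := by simp [seqProd]

/-- `P_{n+1} = P_n · f_n`. [folklore] -/
theorem seqProd_succ (f : ℕ → ℤ → ℂ) (n : ℕ) (η : ℤ) :
    seqProd f (n + 1) η = seqProd f n η * f n η := by
  simp [seqProd, Finset.prod_range_succ]

/-- **Product lemma (values and two differences).** Let `f_j : ℤ → ℂ`, `r_j > 0`, `d₁, d₂ ≥ 0` with
`|f_j(η)| ≤ r_j` for `η ∈ {ξ, ξ+1, ξ+2}`, `|f_j(η+1) - f_j(η)| ≤ d₁` for `η ∈ {ξ, ξ+1}` and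
`|f_j(ξ+2) - 2f_j(ξ+1) + f_j(ξ)| ≤ d₂` (`j < n`). Then with `R = ∏ r_j`, `S = ∑ r_j⁻¹`:
`|P(η)| ≤ R` on the window, `|P(η+1) - P(η)| ≤ d₁ R S` for `η ∈ {ξ, ξ+1}`, and
`|P(ξ+2) - 2P(ξ+1) + P(ξ)| ≤ R (d₂ S + d₁² S²)` (discrete Leibniz rule and induction on `n`).
[folklore] -/
theorem seqProd_bounds (hr : ∀ j, 0 < r j) (hd₁ : 0 ≤ d₁) (hd₂ : 0 ≤ d₂)
    (h0 : ∀ j, ‖f j ξ‖ ≤ r j) (h1 : ∀ j, ‖f j (ξ + 1)‖ ≤ r j) (h2 : ∀ j, ‖f j (ξ + 2)‖ ≤ r j)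
    (hΔ0 : ∀ j, ‖f j (ξ + 1) - f j ξ‖ ≤ d₁) (hΔ1 : ∀ j, ‖f j (ξ + 2) - f j (ξ + 1)‖ ≤ d₁)
    (hΔ₂ : ∀ j, ‖f j (ξ + 2) - 2 * f j (ξ + 1) + f j ξ‖ ≤ d₂) (n : ℕ) :
    (‖seqProd f n ξ‖ ≤ ∏ j ∈ Finset.range n, r j) ∧
    (‖seqProd f n (ξ + 1)‖ ≤ ∏ j ∈ Finset.range n, r j) ∧
    (‖seqProd f n (ξ + 2)‖ ≤ ∏ j ∈ Finset.range n, r j) ∧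
    (‖seqProd f n (ξ + 1) - seqProd f n ξ‖ ≤
      d₁ * (∏ j ∈ Finset.range n, r j) * ∑ j ∈ Finset.range n, (r j)⁻¹) ∧
    (‖seqProd f n (ξ + 2) - seqProd f n (ξ + 1)‖ ≤
      d₁ * (∏ j ∈ Finset.range n, r j) * ∑ j ∈ Finset.range n, (r j)⁻¹) ∧
    (‖seqProd f n (ξ + 2) - 2 * seqProd f n (ξ + 1) + seqProd f n ξ‖ ≤
      (∏ j ∈ Finset.range n, r j) * (d₂ * (∑ j ∈ Finset.range n, (r j)⁻¹) +
        d₁ ^ 2 * (∑ j ∈ Finset.range n, (r j)⁻¹) ^ 2)) := by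
  induction n with
  | zero => simp [seqProd]; norm_num
  | succ n ih =>
    obtain ⟨ih0, ih1, ih2, ihΔ0, ihΔ1, ihΔ₂⟩ := ih
    set R := ∏ j ∈ Finset.range n, r j with hR
    set S := ∑ j ∈ Finset.range n, (r j)⁻¹ with hS
    have hR0 : 0 ≤ R := Finset.prod_nonneg fun j _ => (hr j).le
    have hS0 : 0 ≤ S := Finset.sum_nonneg fun j _ => (inv_pos.mpr (hr j)).le
    have hrn := hr n
    rw [Finset.prod_range_succ, Finset.sum_range_succ, ← hR, ← hS]
    simp only [seqProd_succ]
    set P0 := seqProd f n ξ with hP0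
    set P1 := seqProd f n (ξ + 1) with hP1
    set P2 := seqProd f n (ξ + 2) with hP2
    have nP0 := ih0; have nP1 := ih1; have nP2 := ih2
    refine ⟨?_, ?_, ?_, ?_, ?_, ?_⟩
    · rw [norm_mul]; exact mul_le_mul nP0 (h0 n) (norm_nonneg _) hR0
    · rw [norm_mul]; exact mul_le_mul nP1 (h1 n) (norm_nonneg _) hR0
    · rw [norm_mul]; exact mul_le_mul nP2 (h2 n) (norm_nonneg _) hR0
    · -- Δ(P f)(ξ) = P(ξ+1) Δf(ξ) + ΔP(ξ) f(ξ)
      have hid : P1 * f n (ξ + 1) - P0 * f n ξ =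
          P1 * (f n (ξ + 1) - f n ξ) + (P1 - P0) * f n ξ := by ring
      rw [hid]
      refine (norm_add_le _ _).trans ?_
      rw [norm_mul, norm_mul]
      have hA : ‖P1‖ * ‖f n (ξ + 1) - f n ξ‖ ≤ R * d₁ :=
        mul_le_mul nP1 (hΔ0 n) (norm_nonneg _) hR0
      have hB : ‖P1 - P0‖ * ‖f n ξ‖ ≤ (d₁ * R * S) * r n :=
        mul_le_mul ihΔ0 (h0 n) (norm_nonneg _) (by positivity)
      have hkey : R * d₁ + d₁ * R * S * r n = d₁ * (R * r n) * (S + (r n)⁻¹) := by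
        field_simp
        ring
      linarith [hA, hB, hkey.le, hkey.ge]
    · have hid : P2 * f n (ξ + 2) - P1 * f n (ξ + 1) =
          P2 * (f n (ξ + 2) - f n (ξ + 1)) + (P2 - P1) * f n (ξ + 1) := by ring
      rw [hid]
      refine (norm_add_le _ _).trans ?_
      rw [norm_mul, norm_mul]
      have hA : ‖P2‖ * ‖f n (ξ + 2) - f n (ξ + 1)‖ ≤ R * d₁ :=
        mul_le_mul nP2 (hΔ1 n) (norm_nonneg _) hR0
      have hB : ‖P2 - P1‖ * ‖f n (ξ + 1)‖ ≤ (d₁ * R * S) * r n :=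
        mul_le_mul ihΔ1 (h1 n) (norm_nonneg _) (by positivity)
      have hkey : R * d₁ + d₁ * R * S * r n = d₁ * (R * r n) * (S + (r n)⁻¹) := by
        field_simp
        ring
      linarith [hA, hB, hkey.le, hkey.ge]
    · -- Δ²(P f)(ξ) = P(ξ+2) Δ²f(ξ) + 2 ΔP(ξ+1) Δf(ξ) + Δ²P(ξ) f(ξ)
      have hid : P2 * f n (ξ + 2) - 2 * (P1 * f n (ξ + 1)) + P0 * f n ξ =
          P2 * (f n (ξ + 2) - 2 * f n (ξ + 1) + f n ξ) +
          2 * ((P2 - P1) * (f n (ξ + 1) - f n ξ)) + (P2 - 2 * P1 + P0) * f n ξ := by ring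
      rw [hid]
      refine (norm_add₃_le).trans ?_
      rw [norm_mul, norm_mul, norm_mul, norm_mul, Complex.norm_two]
      have hA : ‖P2‖ * ‖f n (ξ + 2) - 2 * f n (ξ + 1) + f n ξ‖ ≤ R * d₂ :=
        mul_le_mul nP2 (hΔ₂ n) (norm_nonneg _) hR0
      have hB : 2 * (‖P2 - P1‖ * ‖f n (ξ + 1) - f n ξ‖) ≤ 2 * ((d₁ * R * S) * d₁) :=
        mul_le_mul_of_nonneg_left (mul_le_mul ihΔ1 (hΔ0 n) (norm_nonneg _) (by positivity))
          (by norm_num)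
      have hC : ‖P2 - 2 * P1 + P0‖ * ‖f n ξ‖ ≤ (R * (d₂ * S + d₁ ^ 2 * S ^ 2)) * r n :=
        mul_le_mul ihΔ₂ (h0 n) (norm_nonneg _) (by positivity)
      have hkey : R * d₂ + 2 * (d₁ * R * S * d₁) + R * (d₂ * S + d₁ ^ 2 * S ^ 2) * r n +
          R * r n * (d₁ ^ 2 * (r n)⁻¹ ^ 2) =
          R * r n * (d₂ * (S + (r n)⁻¹) + d₁ ^ 2 * (S + (r n)⁻¹) ^ 2) := by
        field_simp
        ring
      have hextra : 0 ≤ R * r n * (d₁ ^ 2 * (r n)⁻¹ ^ 2) := by positivity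
      linarith [hA, hB, hC, hkey.le, hkey.ge, hextra]

end ProductDifferences

/-! ### Discrete Leibniz bounds for first and second differences -/

section Leibniz

/-- `|P(ξ+1)V(ξ+1) - P(ξ)V(ξ)| ≤ |P(ξ+1)| |ΔV(ξ)| + |ΔP(ξ)| |V(ξ)|`. [folklore] -/
theorem norm_diff_mul_le (P V : ℤ → ℂ) (ξ : ℤ) :
    ‖P (ξ + 1) * V (ξ + 1) - P ξ * V ξ‖ ≤
      ‖P (ξ + 1)‖ * ‖V (ξ + 1) - V ξ‖ + ‖P (ξ + 1) - P ξ‖ * ‖V ξ‖ := by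
  have : P (ξ + 1) * V (ξ + 1) - P ξ * V ξ =
      P (ξ + 1) * (V (ξ + 1) - V ξ) + (P (ξ + 1) - P ξ) * V ξ := by ring
  rw [this]
  exact (norm_add_le _ _).trans (by rw [norm_mul, norm_mul])

/-- `|Δ²(PV)(ξ)| ≤ |P(ξ+2)| |Δ²V(ξ)| + 2|ΔP(ξ+1)| |ΔV(ξ)| + |Δ²P(ξ)| |V(ξ)|`. [folklore] -/
theorem norm_second_diff_mul_le (P V : ℤ → ℂ) (ξ : ℤ) :
    ‖P (ξ + 2) * V (ξ + 2) - 2 * (P (ξ + 1) * V (ξ + 1)) + P ξ * V ξ‖ ≤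
      ‖P (ξ + 2)‖ * ‖V (ξ + 2) - 2 * V (ξ + 1) + V ξ‖ +
      2 * (‖P (ξ + 2) - P (ξ + 1)‖ * ‖V (ξ + 1) - V ξ‖) +
      ‖P (ξ + 2) - 2 * P (ξ + 1) + P ξ‖ * ‖V ξ‖ := by
  have : P (ξ + 2) * V (ξ + 2) - 2 * (P (ξ + 1) * V (ξ + 1)) + P ξ * V ξ =
      P (ξ + 2) * (V (ξ + 2) - 2 * V (ξ + 1) + V ξ) +
      2 * ((P (ξ + 2) - P (ξ + 1)) * (V (ξ + 1) - V ξ)) +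
      (P (ξ + 2) - 2 * P (ξ + 1) + P ξ) * V ξ := by ring
  rw [this]
  refine (norm_add₃_le).trans ?_
  rw [norm_mul, norm_mul, norm_mul, norm_mul, Complex.norm_two]

/-- First difference of the derivative weights: `|(ξ+1)a(ξ+1) - ξa(ξ)| ≤ |ξ| |Δa(ξ)| + |a(ξ+1)|`.
[folklore] -/
theorem norm_diff_mul_id_le (a : ℤ → ℂ) (ξ : ℤ) :
    ‖((ξ + 1 : ℤ) : ℂ) * a (ξ + 1) - (ξ : ℂ) * a ξ‖ ≤ |(ξ : ℝ)| * ‖a (ξ + 1) - a ξ‖ + ‖a (ξ + 1)‖ := by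
  have : ((ξ + 1 : ℤ) : ℂ) * a (ξ + 1) - (ξ : ℂ) * a ξ = (ξ : ℂ) * (a (ξ + 1) - a ξ) + a (ξ + 1) := by
    push_cast; ring
  rw [this]
  refine (norm_add_le _ _).trans (le_of_eq ?_)
  rw [norm_mul, Complex.norm_intCast]

/-- Second difference of the second-derivative weights:
`|(ξ+2)²a(ξ+2) - 2(ξ+1)²a(ξ+1) + ξ²a(ξ)| ≤ ξ²|Δ²a(ξ)| + 4|ξ+1| |Δa(ξ+1)| + 2|a(ξ+1)|`. [folklore] -/
theorem norm_second_diff_mul_sq_le (a : ℤ → ℂ) (ξ : ℤ) :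
    ‖((ξ + 2 : ℤ) : ℂ) ^ 2 * a (ξ + 2) - 2 * (((ξ + 1 : ℤ) : ℂ) ^ 2 * a (ξ + 1)) + (ξ : ℂ) ^ 2 * a ξ‖ ≤
      (ξ : ℝ) ^ 2 * ‖a (ξ + 2) - 2 * a (ξ + 1) + a ξ‖ +
      4 * |((ξ + 1 : ℤ) : ℝ)| * ‖a (ξ + 2) - a (ξ + 1)‖ + 2 * ‖a (ξ + 1)‖ := by
  have : ((ξ + 2 : ℤ) : ℂ) ^ 2 * a (ξ + 2) - 2 * (((ξ + 1 : ℤ) : ℂ) ^ 2 * a (ξ + 1)) + (ξ : ℂ) ^ 2 * a ξ =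
      (ξ : ℂ) ^ 2 * (a (ξ + 2) - 2 * a (ξ + 1) + a ξ) +
      4 * (((ξ + 1 : ℤ) : ℂ) * (a (ξ + 2) - a (ξ + 1))) + 2 * a (ξ + 1) := by
    push_cast; ring
  rw [this]
  refine (norm_add₃_le).trans (le_of_eq ?_)
  rw [norm_mul, norm_pow, Complex.norm_intCast, norm_mul, norm_mul, Complex.norm_intCast, norm_mul,
    Complex.norm_two, sq_abs]
  norm_num
  ring

end Leibniz

/-! ### Gaussian lattice sums with polynomial weights -/

section GaussSums

open Literature.Analysis.SpecialFunctions

/-- `∑_{ξ∈ℤ} e^{-cξ²}` is summable for `c > 0` (geometric comparison via `cξ² ≥ c|ξ| - c/4`).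
[folklore] -/
theorem summable_int_gauss {c : ℝ} (hc : 0 < c) :
    Summable fun ξ : ℤ => rexp (-(c * (ξ : ℝ) ^ 2)) := by
  have hgeo : Summable fun n : ℕ => rexp (n * (-c)) :=
    Real.summable_exp_nat_mul_iff.2 (by linarith)
  have hZ : Summable fun ξ : ℤ => rexp (-c * |(ξ : ℝ)|) := by
    refine Summable.of_nat_of_neg ?_ ?_
    · refine hgeo.congr fun n => ?_
      rw [Int.cast_natCast, Nat.abs_cast]; ring_nf
    · refine hgeo.congr fun n => ?_
      rw [Int.cast_neg, Int.cast_natCast, abs_neg, Nat.abs_cast]; ring_nf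
  refine .of_nonneg_of_le (fun ξ => (exp_pos _).le) (fun ξ => ?_) (hZ.mul_left (rexp (c / 4)))
  rw [← Real.exp_add, Real.exp_le_exp]
  nlinarith [sq_nonneg (|(ξ : ℝ)| - 1 / 2), sq_abs (ξ : ℝ)]

/-- `∑_{ξ∈ℤ} e^{-cξ²} ≤ 3√π/√c` for `0 < c ≤ 1` (Jacobi/Poisson: `G(c) = √(π/c) G(π²/c)` and
`G ≤ 3` on `[1, ∞)`). [folklore] -/
theorem tsum_int_gauss_le {c : ℝ} (hc : 0 < c) (hc1 : c ≤ 1) :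
    ∑' ξ : ℤ, rexp (-(c * (ξ : ℝ) ^ 2)) ≤ 3 * Real.sqrt π / Real.sqrt c := by
  have h := gaussLatticeSum_poisson hc
  have h3 : gaussLatticeSum (π ^ 2 / c) ≤ 3 := by
    refine gaussLatticeSum_le_three ?_
    rw [le_div_iff₀ hc]
    nlinarith [Real.pi_gt_three]
  show gaussLatticeSum c ≤ _
  rw [h, Real.sqrt_div' _ hc.le]
  calc Real.sqrt π / Real.sqrt c * gaussLatticeSum (π ^ 2 / c)
      ≤ Real.sqrt π / Real.sqrt c * 3 := by gcongr
    _ = 3 * Real.sqrt π / Real.sqrt c := by ring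

/-- `x^l e^{-x²/2} ≤ 1 + 2^l l!` for `x ≥ 0` (`yˡ/l! ≤ eʸ`). [folklore] -/
theorem pow_mul_exp_neg_half_sq_le (l : ℕ) {x : ℝ} (hx : 0 ≤ x) :
    x ^ l * rexp (-(x ^ 2 / 2)) ≤ 1 + 2 ^ l * l.factorial := by
  have hE := Real.pow_div_factorial_le_exp (x ^ 2 / 2) (by positivity) l
  have hfac : (0 : ℝ) < l.factorial := by positivity
  have hexp : 0 < rexp (x ^ 2 / 2) := exp_pos _
  -- `x^l ≤ 1 + x^{2l}`
  have hxl : x ^ l ≤ 1 + x ^ (2 * l) := by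
    rcases le_or_gt x 1 with h | h
    · have : x ^ l ≤ 1 := pow_le_one₀ hx h
      linarith [pow_nonneg hx (2 * l)]
    · have : x ^ l ≤ x ^ (2 * l) := pow_le_pow_right₀ h.le (by omega)
      linarith
  have h2l : x ^ (2 * l) = 2 ^ l * (x ^ 2 / 2) ^ l := by
    rw [div_pow, pow_mul]; field_simp
  rw [Real.exp_neg]
  have hb : x ^ (2 * l) * (rexp (x ^ 2 / 2))⁻¹ ≤ 2 ^ l * l.factorial := by
    rw [h2l, mul_assoc]
    refine mul_le_mul_of_nonneg_left ?_ (by positivity)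
    rw [← div_eq_mul_inv, div_le_iff₀ hexp]
    rw [div_le_iff₀ hfac] at hE
    linarith
  have h1 : (1 : ℝ) * (rexp (x ^ 2 / 2))⁻¹ ≤ 1 := by
    rw [one_mul, inv_le_one_iff₀]; right; exact Real.one_le_exp (by positivity)
  calc x ^ l * (rexp (x ^ 2 / 2))⁻¹ ≤ (1 + x ^ (2 * l)) * (rexp (x ^ 2 / 2))⁻¹ :=
        mul_le_mul_of_nonneg_right hxl (by positivity)
    _ = 1 * (rexp (x ^ 2 / 2))⁻¹ + x ^ (2 * l) * (rexp (x ^ 2 / 2))⁻¹ := by ring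
    _ ≤ 1 + 2 ^ l * l.factorial := add_le_add h1 hb

/-- Pointwise: `|ξ|ˡ e^{-cξ²} ≤ (1 + 2ˡl!) (√c)^{-l} e^{-(c/2)ξ²}`. [folklore] -/
theorem abs_pow_mul_gauss_le (l : ℕ) {c : ℝ} (hc : 0 < c) (ξ : ℤ) :
    |(ξ : ℝ)| ^ l * rexp (-(c * (ξ : ℝ) ^ 2)) ≤
      (1 + 2 ^ l * l.factorial) / Real.sqrt c ^ l * rexp (-(c / 2 * (ξ : ℝ) ^ 2)) := by
  have hsc : 0 < Real.sqrt c := Real.sqrt_pos.mpr hc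
  have hx : 0 ≤ Real.sqrt c * |(ξ : ℝ)| := by positivity
  have h := pow_mul_exp_neg_half_sq_le l hx
  have hx2 : (Real.sqrt c * |(ξ : ℝ)|) ^ 2 / 2 = c / 2 * (ξ : ℝ) ^ 2 := by
    rw [mul_pow, sq_abs, Real.sq_sqrt hc.le]; ring
  rw [hx2, mul_pow] at h
  have hsplit : rexp (-(c * (ξ : ℝ) ^ 2)) = rexp (-(c / 2 * (ξ : ℝ) ^ 2)) *
      rexp (-(c / 2 * (ξ : ℝ) ^ 2)) := by
    rw [← Real.exp_add]; congr 1; ring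
  rw [hsplit, ← mul_assoc]
  refine mul_le_mul_of_nonneg_right ?_ (exp_pos _).le
  rw [le_div_iff₀ (pow_pos hsc l)]
  calc |(ξ : ℝ)| ^ l * rexp (-(c / 2 * (ξ : ℝ) ^ 2)) * Real.sqrt c ^ l
      = Real.sqrt c ^ l * |(ξ : ℝ)| ^ l * rexp (-(c / 2 * (ξ : ℝ) ^ 2)) := by ring
    _ ≤ 1 + 2 ^ l * l.factorial := h

/-- `∑_{ξ∈ℤ} |ξ|ˡ e^{-cξ²}` is summable. [folklore] -/
theorem summable_abs_pow_mul_gauss (l : ℕ) {c : ℝ} (hc : 0 < c) :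
    Summable fun ξ : ℤ => |(ξ : ℝ)| ^ l * rexp (-(c * (ξ : ℝ) ^ 2)) :=
  .of_nonneg_of_le (fun ξ => by positivity) (fun ξ => abs_pow_mul_gauss_le l hc ξ)
    ((summable_int_gauss (half_pos hc)).mul_left _)

/-- **Weighted Gaussian lattice sums**: `∑_{ξ∈ℤ} |ξ|ˡ e^{-cξ²} ≤ K_l/(√c)^{l+1}` for `0 < c ≤ 1`,
`K_l = 3√(2π)(1 + 2ˡl!)` — the lattice analogue of `∫ |x|ˡ e^{-cx²} dx ≍ c^{-(l+1)/2}`, valid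
uniformly down to `c → 0` (this is where `nw² ≤ 1` enters (5.9)). [folklore] -/
theorem tsum_abs_pow_mul_gauss_le (l : ℕ) {c : ℝ} (hc : 0 < c) (hc1 : c ≤ 1) :
    ∑' ξ : ℤ, |(ξ : ℝ)| ^ l * rexp (-(c * (ξ : ℝ) ^ 2)) ≤
      3 * Real.sqrt (2 * π) * (1 + 2 ^ l * l.factorial) / Real.sqrt c ^ (l + 1) := by
  have hsc : 0 < Real.sqrt c := Real.sqrt_pos.mpr hc
  have h1 := (summable_abs_pow_mul_gauss l hc).tsum_le_tsum (fun ξ => abs_pow_mul_gauss_le l hc ξ)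
    ((summable_int_gauss (half_pos hc)).mul_left _)
  refine h1.trans ?_
  rw [tsum_mul_left]
  have h2 := tsum_int_gauss_le (half_pos hc) (by linarith)
  have hsqrt : Real.sqrt (c / 2) = Real.sqrt c / Real.sqrt 2 := Real.sqrt_div' c zero_le_two
  rw [hsqrt] at h2
  have hs2 : 0 < Real.sqrt 2 := Real.sqrt_pos.mpr two_pos
  calc (1 + 2 ^ l * ↑l.factorial) / Real.sqrt c ^ l * ∑' ξ : ℤ, rexp (-(c / 2 * (ξ : ℝ) ^ 2))
      ≤ (1 + 2 ^ l * ↑l.factorial) / Real.sqrt c ^ l * (3 * Real.sqrt π / (Real.sqrt c / Real.sqrt 2)) :=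
        mul_le_mul_of_nonneg_left h2 (by positivity)
    _ = 3 * (Real.sqrt 2 * Real.sqrt π) * (1 + 2 ^ l * l.factorial) / Real.sqrt c ^ (l + 1) := by
        field_simp
        ring
    _ = 3 * Real.sqrt (2 * π) * (1 + 2 ^ l * l.factorial) / Real.sqrt c ^ (l + 1) := by
        rw [← Real.sqrt_mul zero_le_two]

end GaussSums

/-! ### Power tails `∑_{|ξ| > N} |ξ|^{-(q+2)}` -/

section Tails

/-- The tail weight `1/|ξ|^{q+2}` beyond `N`, zero inside. [folklore] -/
def tailWeight (N q : ℕ) (ξ : ℤ) : ℝ := if (N : ℤ) < |ξ| then 1 / |(ξ : ℝ)| ^ (q + 2) else 0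

/-- The tail weight is non-negative. [folklore] -/
theorem tailWeight_nonneg (N q : ℕ) (ξ : ℤ) : 0 ≤ tailWeight N q ξ := by
  unfold tailWeight; split_ifs <;> positivity

/-- The tail weight is even. [folklore] -/
theorem tailWeight_neg (N q : ℕ) (ξ : ℤ) : tailWeight N q (-ξ) = tailWeight N q ξ := by
  simp [tailWeight, abs_neg]

/-- Polynomial weights shift the tail exponent: `|ξ|ᵖ/|ξ|^{q+p+2} = 1/|ξ|^{q+2}` beyond `N`.
[folklore] -/
theorem abs_pow_mul_tailWeight (N q p : ℕ) (ξ : ℤ) :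
    |(ξ : ℝ)| ^ p * tailWeight N (q + p) ξ = tailWeight N q ξ := by
  unfold tailWeight
  split_ifs with h
  · have hξ : (0 : ℝ) < |(ξ : ℝ)| := by
      rw [← Int.cast_abs]; exact_mod_cast (lt_of_le_of_lt (Int.natCast_nonneg N) h)
    rw [show q + p + 2 = (q + 2) + p by ring, pow_add]
    field_simp
  · rw [mul_zero]

/-- Beyond `N`: `1/|ξ|^{q+2} = tailWeight N q ξ`. [folklore] -/
theorem tailWeight_of_lt {N : ℕ} {ξ : ℤ} (h : (N : ℤ) < |ξ|) (q : ℕ) :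
    tailWeight N q ξ = 1 / |(ξ : ℝ)| ^ (q + 2) := by
  unfold tailWeight; rw [if_pos h]

/-- On the positive integers the tail weight is `1/k^{q+2}` for `k > N`: bounded by the
telescoping `N^{-q} (1/(k-1) - 1/k)`. [folklore] -/
theorem tailWeight_natSucc_le (N q : ℕ) (hN : 1 ≤ N) (k : ℕ) :
    tailWeight N q ((k : ℤ) + 1) ≤
      1 / (N : ℝ) ^ q * (if N ≤ k then (1 / (k : ℝ) - 1 / ((k : ℝ) + 1)) else 0) := by
  unfold tailWeight
  have hk1 : |((k : ℤ) + 1 : ℤ)| = (k : ℤ) + 1 := abs_of_nonneg (by positivity)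
  rw [hk1]
  push_cast
  rw [abs_of_nonneg (by positivity : (0 : ℝ) ≤ (k : ℝ) + 1)]
  by_cases h : N ≤ k
  · have hNk : ((N : ℤ) < (k : ℤ) + 1) := by exact_mod_cast Nat.lt_succ_of_le h
    rw [if_pos hNk, if_pos h]
    have hk0 : (0 : ℝ) < k := by exact_mod_cast (lt_of_lt_of_le (by omega : 0 < N) h)
    have hN0 : (0 : ℝ) < N := by exact_mod_cast (by omega : 0 < N)
    have hNk' : (N : ℝ) ≤ k := by exact_mod_cast h
    rw [div_sub_div _ _ hk0.ne' (by positivity), one_mul, mul_one,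
      show (k : ℝ) + 1 - k = 1 by ring, one_div_mul_one_div, div_le_div_iff₀ (by positivity)
      (by positivity), one_mul, one_mul]
    calc (N : ℝ) ^ q * ((k : ℝ) * (k + 1)) ≤ (k : ℝ) ^ q * ((k + 1) * (k + 1)) := by
          gcongr
          linarith
      _ = (k + 1 : ℝ) ^ 2 * (k : ℝ) ^ q := by ring
      _ ≤ (k + 1 : ℝ) ^ 2 * (k + 1 : ℝ) ^ q := by gcongr; linarith
      _ = (k + 1 : ℝ) ^ (q + 2) := by ring
  · have hNk : ¬ ((N : ℤ) < (k : ℤ) + 1) := by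
      push Not at h ⊢; exact_mod_cast h
    rw [if_neg hNk, if_neg h, mul_zero]

/-- The telescoping sum `∑_{k ≥ N} (1/k - 1/(k+1)) ≤ 1/N`. [folklore] -/
theorem tsum_telescope_le (N : ℕ) (hN : 1 ≤ N) :
    Summable (fun k : ℕ => if N ≤ k then (1 / (k : ℝ) - 1 / ((k : ℝ) + 1)) else 0) ∧
    ∑' k : ℕ, (if N ≤ k then (1 / (k : ℝ) - 1 / ((k : ℝ) + 1)) else 0) ≤ 1 / N := by
  set g : ℕ → ℝ := fun k => if N ≤ k then (1 / (k : ℝ) - 1 / ((k : ℝ) + 1)) else 0 with hg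
  have hg0 : ∀ k, 0 ≤ g k := fun k => by
    simp only [hg]
    split_ifs with h
    · have hk : (1 : ℝ) ≤ k := by exact_mod_cast hN.trans h
      rw [sub_nonneg]
      exact one_div_le_one_div_of_le (by linarith) (by linarith)
    · exact le_rfl
  -- partial sums telescope
  have hpartial : ∀ M, ∑ k ∈ Finset.range M, g k ≤ 1 / N := by
    intro M
    have key : ∀ M, N ≤ M → ∑ k ∈ Finset.range M, g k = 1 / N - 1 / M := by
      intro M hM
      induction M, hM using Nat.le_induction with
      | base =>
        rw [Finset.sum_eq_zero]
        · simp
        · intro k hk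
          simp only [hg, Finset.mem_range] at hk ⊢
          rw [if_neg (by omega)]
      | succ M hM ih =>
        rw [Finset.sum_range_succ, ih]
        simp only [hg, if_pos hM]
        push_cast
        ring
    rcases le_or_gt N M with h | h
    · rw [key M h]
      have : (0 : ℝ) ≤ 1 / M := by positivity
      linarith
    · rw [Finset.sum_eq_zero]
      · positivity
      · intro k hk
        simp only [hg, Finset.mem_range] at hk ⊢
        rw [if_neg (by omega)]
  have hsum : Summable g := by
    refine summable_of_sum_range_le hg0 hpartial
  exact ⟨hsum, hsum.tsum_le_of_sum_range_le hpartial⟩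

/-- **Power tails**: `∑_{ξ∈ℤ, |ξ|>N} |ξ|^{-(q+2)} ≤ 2/N^{q+1}` for `N ≥ 1`, and the summand family is
summable. [folklore] -/
theorem tsum_tailWeight_le (N q : ℕ) (hN : 1 ≤ N) :
    Summable (tailWeight N q) ∧ ∑' ξ : ℤ, tailWeight N q ξ ≤ 2 / (N : ℝ) ^ (q + 1) := by
  obtain ⟨hgs, hgle⟩ := tsum_telescope_le N hN
  set g : ℕ → ℝ := fun k => if N ≤ k then (1 / (k : ℝ) - 1 / ((k : ℝ) + 1)) else 0 with hg
  have hN0 : (0 : ℝ) < N := by exact_mod_cast (by omega : 0 < N)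
  have hnat : ∀ k : ℕ, tailWeight N q ((k : ℤ) + 1) ≤ 1 / (N : ℝ) ^ q * g k :=
    fun k => tailWeight_natSucc_le N q hN k
  have hs1 : Summable fun k : ℕ => tailWeight N q ((k : ℤ) + 1) :=
    .of_nonneg_of_le (fun k => tailWeight_nonneg _ _ _) hnat (hgs.mul_left _)
  have hs2 : Summable fun k : ℕ => tailWeight N q (-((k : ℤ) + 1)) := by
    simpa only [tailWeight_neg] using hs1
  have hsum : Summable (tailWeight N q) := .of_add_one_of_neg_add_one hs1 hs2
  refine ⟨hsum, ?_⟩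
  rw [tsum_of_add_one_of_neg_add_one hs1 hs2]
  simp only [tailWeight_neg]
  have h0 : tailWeight N q 0 = 0 := by
    simp only [tailWeight, abs_zero]
    rw [if_neg (by exact_mod_cast Nat.not_lt_zero N)]
  have htail : ∑' k : ℕ, tailWeight N q ((k : ℤ) + 1) ≤ 1 / (N : ℝ) ^ (q + 1) := by
    calc ∑' k : ℕ, tailWeight N q ((k : ℤ) + 1) ≤ ∑' k : ℕ, 1 / (N : ℝ) ^ q * g k :=
          hs1.tsum_le_tsum hnat (hgs.mul_left _)
      _ = 1 / (N : ℝ) ^ q * ∑' k : ℕ, g k := tsum_mul_left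
      _ ≤ 1 / (N : ℝ) ^ q * (1 / N) := mul_le_mul_of_nonneg_left hgle (by positivity)
      _ = 1 / (N : ℝ) ^ (q + 1) := by rw [pow_succ]; field_simp
  rw [h0, add_zero]
  calc ∑' k : ℕ, tailWeight N q ((k : ℤ) + 1) + ∑' k : ℕ, tailWeight N q ((k : ℤ) + 1)
      ≤ 1 / (N : ℝ) ^ (q + 1) + 1 / (N : ℝ) ^ (q + 1) := add_le_add htail htail
    _ = 2 / (N : ℝ) ^ (q + 1) := by ring

end Tails

/-! ### Exponentials beat polynomials -/

section ExpPoly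

/-- For `0 ≤ A < 1` and `p ∈ ℕ` the sequence `Aᵍ gᵖ` is bounded. [folklore] -/
theorem exists_bound_pow_mul_pow {A : ℝ} (hA0 : 0 ≤ A) (hA1 : A < 1) (p : ℕ) :
    ∃ C : ℝ, 0 < C ∧ ∀ g : ℕ, A ^ g * (g : ℝ) ^ p ≤ C := by
  have h := tendsto_pow_const_mul_const_pow_of_abs_lt_one p (show |A| < 1 by
    rwa [abs_of_nonneg hA0])
  obtain ⟨C, hC⟩ := h.bddAbove_range
  refine ⟨max C 1, by positivity, fun g => ?_⟩
  have := hC ⟨g, rfl⟩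
  rw [mul_comm]
  exact this.trans (le_max_left _ _)

end ExpPoly

end Literature.Barriers.AtomisticToContinuum.HeatConduction
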